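import Summits.ABC.IUTFork.Cor312TeamBCapstoneSummands
import HarnessLib

/-!
# [IUTchIII] Cor. 3.12, TEAM B capstone at the verbatim weighted container: the residuals `hθ`, `hfin` when (Ind3)
# is idle at region level (proof-only companion of `Cor312TeamBCapstoneSummands.lean`)

PROOF-ONLY companion (abc-iut cell, seat abc-iut-w5-d235, WAVE-5; RQ7 second pass of p414525, note N2; announced on
HOME/STATUS 2026-08-26T00:48Z with first refusal to abc-iut-c312-11 / abc-iut-c312-5). TAKES NO SIDE on
[IUTchIII] Cor. 3.12.

abc-iut-c312-6's capstone `SummandPieces.teamB_statement_of_qFrobEqualityAt` (p414525) derives the printed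
`Statement` from TEAM B's B-INPUT `QFrobEqualityAt P 0`, summandwise instance data (`hV`, `hG`, `hΨ`, `hfrobAdm`,
`hfrobLogvol`, `hthetaEq`, `hR`) and four named residuals: `hθ` (the (Ind3)-UNION `P.thetaRegion3 = ⋃_m P.thetaRegion m`
is admissible), `hfin` (its log-volume is finitely supported over `v_ℚ`, [IUTchIII] Prop. 3.9 (iii) p. 117),
`hul_nonempty`, `finite : P.ThetaFinite`. The per-`m` data do NOT give `hθ`/`hfin` in general — a union over `m ∈ ℤ` of
admissible direct product regions need not be one; this is the place where the (Ind3)-variation ([IUTchIII] Thm. 3.11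
(ii), "upper semi-compatible" p. 156 l. 33–39) enters `BridgeHyps`. THIS FILE records the boundary case in which (Ind3)
is IDLE at region level — the `Ψ_m`-transports of the reference region coincide for all `m`
(`hconst : Ψ_m '' (e '' R) = Ψ_0 '' (e '' R)`):

* `image_thetaRegion3_eq_of_constTransport` — then `e '' P.thetaRegion3 = Ψ_0 '' (e '' R)`;
* `thetaRegion3_adm_of_constTransport` — so `hθ` HOLDS (from `(hΨ 0).map_pi`);
* `logvol_thetaRegion3_eq_ref_of_constTransport` — and `μ^log(P.thetaRegion3) = μ^log(R)` packet by packet, so `hfin`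
  is finite support of the REFERENCE volumes;
* `teamB_statement_of_qFrobEqualityAt_of_constTransport` — the capstone with `hθ`, `hfin` replaced by `hconst` + `hfinR`:
  residuals `{hfinR, hul_nonempty, ThetaFinite}` + the B-INPUT.
* §0, for ANY `Cor312.Setting` (so also for abc-iut-c312-7's assembler `Setting.ofComparison`/`ofFrames` and
  abc-iut-c312-5's `settingDHVol`, whose `bridgeHyps_…` leave exactly `hθ`/`hfinθ`/`ThetaFinite`): if the Kummer
  images do not depend on `m` (`P.thetaRegion m = P.thetaRegion 0` — e.g. an `m`-constant `thetaBox` binder, as in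
  the Dupuy–Hilado model where (Ind3) is absorbed into ONE enlarged region), then `P.thetaRegion3 = P.thetaRegion 0`
  (`Setting.thetaRegion3_eq_of_mConst`), so `hθ` follows from `ThetaRegionsAdm` (`Setting.thetaRegion3_adm_of_mConst`)
  and `hfinθ` is the finite support of the single-image volumes (`Setting.thetaRegion3_support_finite_of_mConst`); at
  `Setting.ofFrames` with `m`-constant hull-set Θ-boxes `hθ` holds outright
  (`FrameVolumePieces.thetaRegion3_adm_ofFrames_of_mConst_hullSet`).

Census remark (RQ7 note N1 on p414525): `finite : P.ThetaFinite` is the FIRST conjunct of `Statement` itself (print's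
conclusion "`−|log(Θ)| ∈ ℝ`", p. 174 l. 17, derived in print from compactness p. 175 l. 2–5); every capstone of this
shape proves the INEQUALITY conjunct. [claim: Mochizuki2012, status: disputed] for the Corollary; bookkeeping only;
NO new definition, NO new `Prop`; nothing asserted about the real setting.
-/

noncomputable section

open Set MeasureTheory Metric
open scoped ENNReal

namespace Summit.ABC

namespace IUTFork

namespace Cor312Vol

open Thm311 Cor312 Literature.IUT.LogVolume Literature.IUT.LogThetaLattice

/-! ## 0. Any setting: `m`-independent Kummer images make the (Ind3)-union a single image -/

section AnySetting

variable {T : ThetaIndex} {S : Situation T} (P : Cor312.Setting S)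

/-- If the Kummer images of the Θ-pilot object do not depend on the lattice position `m`, the (Ind3)-union
`P.thetaRegion3 = ⋃_m P.thetaRegion m` ([IUTchIII] Cor. 3.12 p. 173 l. 43 "the union of the possible images") is the
single image `P.thetaRegion 0`. [claim: Mochizuki2012, status: disputed] -/
theorem _root_.Summit.ABC.IUTFork.Cor312.Setting.thetaRegion3_eq_of_mConst
    (h : ∀ (m : ℤ) (j : T.Label) (vQ : T.VQ), P.thetaRegion m j vQ = P.thetaRegion 0 j vQ)
    (j : T.Label) (vQ : T.VQ) : P.thetaRegion3 j vQ = P.thetaRegion 0 j vQ := by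
  unfold Cor312.Setting.thetaRegion3
  simp_rw [h]
  exact Set.iUnion_const _

/-- **`hθ` from `ThetaRegionsAdm` when the images are `m`-independent**: the residual "the (Ind3)-union is admissible"
of abc-iut-c312-5's `bridgeHyps_of_summands` / `bridgeHyps_settingDHVol` reduces to the admissibility of the single
images (abc-iut-c312-11's `ThetaRegionsAdm`, Thm. 3.11 (ii) (a)). [claim: Mochizuki2012, status: disputed] -/
theorem _root_.Summit.ABC.IUTFork.Cor312.Setting.thetaRegion3_adm_of_mConst
    (h : ∀ (m : ℤ) (j : T.Label) (vQ : T.VQ), P.thetaRegion m j vQ = P.thetaRegion 0 j vQ)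
    (hadm : ThetaRegionsAdm P) (i : Fin T.lstar) (vQ : T.VQ) :
    (S.D P.n).Adm _ vQ (P.thetaRegion3 (Setting.labelSucc i) vQ) := by
  rw [P.thetaRegion3_eq_of_mConst h]
  exact hadm 0 i vQ

/-- **`hfinθ` when the images are `m`-independent**: the finite support over `v_ℚ` of the (Ind3)-union's log-volume
([IUTchIII] Prop. 3.9 (iii) p. 117) is that of the single-image volumes. [claim: Mochizuki2012, status: disputed] -/
theorem _root_.Summit.ABC.IUTFork.Cor312.Setting.thetaRegion3_support_finite_of_mConst
    (h : ∀ (m : ℤ) (j : T.Label) (vQ : T.VQ), P.thetaRegion m j vQ = P.thetaRegion 0 j vQ)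
    (hfin0 : ∀ i : Fin T.lstar, (Function.support fun vQ : T.VQ =>
      (S.D P.n).logvol _ vQ (P.thetaRegion 0 (Setting.labelSucc i) vQ)).Finite)
    (i : Fin T.lstar) :
    (Function.support fun vQ : T.VQ => (S.D P.n).logvol _ vQ (P.thetaRegion3 (Setting.labelSucc i) vQ)).Finite := by
  have hf : (fun vQ : T.VQ => (S.D P.n).logvol _ vQ (P.thetaRegion3 (Setting.labelSucc i) vQ)) =
      fun vQ : T.VQ => (S.D P.n).logvol _ vQ (P.thetaRegion 0 (Setting.labelSucc i) vQ) :=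
    funext fun vQ => by rw [P.thetaRegion3_eq_of_mConst h]
  rw [hf]
  exact hfin0 i

end AnySetting

/-! ## 0′. At the frames setting: `m`-constant hull-set Θ-boxes -/

namespace FrameVolumePieces

section Assembled

variable {T : ThetaIndex} {S : Situation T} {V : FrameVolumePieces S.L} {n : ℤ}
  {HT : Type} {LogLink : HT → HT → Type} {IsFull : ∀ {s t : HT}, LogLink s t → Prop}
  (lat : LGPGaussianLogThetaLattice LogLink IsFull)
  {Frd : Type} {IsoF : Frd → Frd → Type} {Ob : Frd → Type} {realify : Frd → Frd} {Strip : Type}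
  {IsoS : Strip → Strip → Type} {M : ∀ v : T.V, v ∈ T.Vbad → Type} [∀ v h, Monoid (M v h)]
  (sig : GlobalLGPFrobenioidSignature T.lstar T.V (· ∈ T.Vbad) Frd IsoF Ob realify Strip IsoS M)
  (split : SplittingMonoids M) {ObΔ : Type} {Nmon : ∀ v : T.V, v ∈ T.Vbad → Type} [∀ v h, Monoid (Nmon v h)]
  (qData : QPilotData ObΔ Nmon)
  (thetaBox : ℤ → Ob sig.Clgp → ∀ j vQ, Set (∀ i, V.K j vQ i))
  (qCentre : ObΔ → ∀ j vQ, ∀ i, V.K j vQ i)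
  (hq : ∀ j vQ i, qCentre (qPilotObject qData) j vQ i ≠ 0)
  (hadm : ∀ j vQ (H : Set (∀ i, V.K j vQ i)), IsHullSet (V.K j vQ) H → (S.D n).Adm j vQ (V.e j vQ ⁻¹' H))
  (hfin : ∀ j : T.Label, (Function.support fun vQ => (S.D n).logvol j vQ
    (V.e j vQ ⁻¹' hullSet (V.K j vQ) (qCentre (qPilotObject qData) j vQ))).Finite)

/-- **`hθ` DISCHARGED at the frames setting for `m`-constant hull-set Θ-boxes** (the (Ind3)-idle instance, e.g. the
Dupuy–Hilado-style single enlarged region): the (Ind3)-union of the Kummer images is the one box `e⁻¹(λ·𝒪_L)`, which is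
admissible by abc-iut-c312-6's `hadm_of_realizes`. [claim: Mochizuki2012, status: disputed] -/
theorem thetaRegion3_adm_ofFrames_of_mConst_hullSet (hV : V.Realizes (S.D n))
    (hconst : ∀ (m : ℤ) (i : Fin T.lstar) (vQ : T.VQ),
      thetaBox m (thetaPilotObject sig split) (Setting.labelSucc i) vQ =
        thetaBox 0 (thetaPilotObject sig split) (Setting.labelSucc i) vQ)
    (hhull : ∀ (i : Fin T.lstar) (vQ : T.VQ),
      IsHullSet (V.K _ vQ) (thetaBox 0 (thetaPilotObject sig split) (Setting.labelSucc i) vQ))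
    (i : Fin T.lstar) (vQ : T.VQ) :
    (S.D (Setting.ofFrames n lat sig split qData (V.toRealFrames thetaBox qCentre) hq hadm hfin).n).Adm _ vQ
      ((Setting.ofFrames n lat sig split qData (V.toRealFrames thetaBox qCentre) hq hadm hfin).thetaRegion3
        (Setting.labelSucc i) vQ) := by
  have h3 : (Setting.ofFrames n lat sig split qData (V.toRealFrames thetaBox qCentre) hq hadm hfin).thetaRegion3
        (Setting.labelSucc i) vQ =
      V.e _ vQ ⁻¹' thetaBox 0 (thetaPilotObject sig split) (Setting.labelSucc i) vQ := by
    unfold Cor312.Setting.thetaRegion3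
    have hm : ∀ m : ℤ,
        (Setting.ofFrames n lat sig split qData (V.toRealFrames thetaBox qCentre) hq hadm hfin).thetaRegion m
          (Setting.labelSucc i) vQ = V.e _ vQ ⁻¹' thetaBox 0 (thetaPilotObject sig split) (Setting.labelSucc i) vQ :=
      fun m => by
        show V.e _ vQ ⁻¹' thetaBox m (thetaPilotObject sig split) (Setting.labelSucc i) vQ = _
        rw [hconst m i vQ]
    simp_rw [hm]
    exact Set.iUnion_const _
  rw [h3]
  exact hadm_of_realizes hV _ vQ _ (hhull i vQ)

end Assembled

end FrameVolumePieces

namespace SummandPieces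

variable {T : ThetaIndex} {S' : LatticeSituation T} (P : Cor312.Setting S'.toSituation)
  (V : SummandPieces S'.L)
  (Ψ : ℤ → ∀ (j : T.Label) (vQ : T.VQ), (∀ e, V.X j vQ e) → ∀ e, V.X j vQ e)
  (R : ∀ (j : T.Label) (vQ : T.VQ), Set (S'.L.Packet j vQ))

/-- **(Ind3) idle at region level ⟹ the (Ind3)-union is the `m = 0` transport**: if every `m`-th Θ-Kummer image is
the `Ψ_m`-transport of the reference region and these transports coincide for all `m`, then
`e '' P.thetaRegion3 = Ψ_0 '' (e '' R)` (`P.thetaRegion3 = ⋃_m P.thetaRegion m`, Cor. 3.12 p. 173 l. 43 "the union of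
the possible images"). [claim: Mochizuki2012, status: disputed] -/
theorem image_thetaRegion3_eq_of_constTransport
    (hthetaEq : ∀ (m : ℤ) (i : Fin T.lstar) (vQ : T.VQ),
      V.e (Setting.labelSucc i) vQ '' P.thetaRegion m (Setting.labelSucc i) vQ =
        Ψ m (Setting.labelSucc i) vQ '' (V.e (Setting.labelSucc i) vQ '' R (Setting.labelSucc i) vQ))
    (hconst : ∀ (m : ℤ) (i : Fin T.lstar) (vQ : T.VQ),
      Ψ m (Setting.labelSucc i) vQ '' (V.e (Setting.labelSucc i) vQ '' R (Setting.labelSucc i) vQ) =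
        Ψ 0 (Setting.labelSucc i) vQ '' (V.e (Setting.labelSucc i) vQ '' R (Setting.labelSucc i) vQ))
    (i : Fin T.lstar) (vQ : T.VQ) :
    V.e (Setting.labelSucc i) vQ '' P.thetaRegion3 (Setting.labelSucc i) vQ =
      Ψ 0 (Setting.labelSucc i) vQ '' (V.e (Setting.labelSucc i) vQ '' R (Setting.labelSucc i) vQ) := by
  unfold Cor312.Setting.thetaRegion3
  rw [Set.image_iUnion]
  simp_rw [hthetaEq, hconst]
  exact Set.iUnion_const _

/-- **`hθ` DISCHARGED when (Ind3) is idle**: the (Ind3)-union `P.thetaRegion3` is admissible at every label in `𝔽_l^⋇`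
(its image is the admissible direct product region `Ψ_0(Π_e R₀_e)`, abc-iut-c312-5 `PreservesRegions.map_pi`).
[claim: Mochizuki2012, status: disputed] -/
theorem thetaRegion3_adm_of_constTransport (hV : V.Realizes (S'.D P.n))
    (hΨ : ∀ (m : ℤ) (j : T.Label) (vQ : T.VQ), V.PreservesRegions j vQ (Ψ m j vQ))
    (hthetaEq : ∀ (m : ℤ) (i : Fin T.lstar) (vQ : T.VQ),
      V.e (Setting.labelSucc i) vQ '' P.thetaRegion m (Setting.labelSucc i) vQ =
        Ψ m (Setting.labelSucc i) vQ '' (V.e (Setting.labelSucc i) vQ '' R (Setting.labelSucc i) vQ))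
    (hR : ∀ (i : Fin T.lstar) (vQ : T.VQ), V.Adm (Setting.labelSucc i) vQ (R (Setting.labelSucc i) vQ))
    (hconst : ∀ (m : ℤ) (i : Fin T.lstar) (vQ : T.VQ),
      Ψ m (Setting.labelSucc i) vQ '' (V.e (Setting.labelSucc i) vQ '' R (Setting.labelSucc i) vQ) =
        Ψ 0 (Setting.labelSucc i) vQ '' (V.e (Setting.labelSucc i) vQ '' R (Setting.labelSucc i) vQ))
    (i : Fin T.lstar) (vQ : T.VQ) :
    (S'.D P.n).Adm _ vQ (P.thetaRegion3 (Setting.labelSucc i) vQ) := by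
  obtain ⟨R₀, hR₀, hadm⟩ := hR i vQ
  obtain ⟨R', hR', hadm', -⟩ := (hΨ 0 _ vQ).map_pi R₀ hadm
  rw [hV.adm_iff]
  exact ⟨R', by rw [image_thetaRegion3_eq_of_constTransport P V Ψ R hthetaEq hconst i vQ, hR₀, hR'], hadm'⟩

/-- **… and `μ^log(P.thetaRegion3) = μ^log(R)`** packet by packet (the transport preserves the weighted log-volume), so
the residual `hfin` is the finite support of the REFERENCE volumes. [claim: Mochizuki2012, status: disputed] -/
theorem logvol_thetaRegion3_eq_ref_of_constTransport (hV : V.Realizes (S'.D P.n))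
    (hΨ : ∀ (m : ℤ) (j : T.Label) (vQ : T.VQ), V.PreservesRegions j vQ (Ψ m j vQ))
    (hthetaEq : ∀ (m : ℤ) (i : Fin T.lstar) (vQ : T.VQ),
      V.e (Setting.labelSucc i) vQ '' P.thetaRegion m (Setting.labelSucc i) vQ =
        Ψ m (Setting.labelSucc i) vQ '' (V.e (Setting.labelSucc i) vQ '' R (Setting.labelSucc i) vQ))
    (hR : ∀ (i : Fin T.lstar) (vQ : T.VQ), V.Adm (Setting.labelSucc i) vQ (R (Setting.labelSucc i) vQ))
    (hconst : ∀ (m : ℤ) (i : Fin T.lstar) (vQ : T.VQ),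
      Ψ m (Setting.labelSucc i) vQ '' (V.e (Setting.labelSucc i) vQ '' R (Setting.labelSucc i) vQ) =
        Ψ 0 (Setting.labelSucc i) vQ '' (V.e (Setting.labelSucc i) vQ '' R (Setting.labelSucc i) vQ))
    (i : Fin T.lstar) (vQ : T.VQ) :
    (S'.D P.n).logvol _ vQ (P.thetaRegion3 (Setting.labelSucc i) vQ) =
      (S'.D P.n).logvol _ vQ (R (Setting.labelSucc i) vQ) := by
  obtain ⟨R₀, hR₀, hadm⟩ := hR i vQ
  obtain ⟨R', hR', hadm', hvol⟩ := (hΨ 0 _ vQ).map_pi R₀ hadm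
  rw [hV.logvol_eq, hV.logvol_eq,
    logvol_eq_of_pi (by rw [image_thetaRegion3_eq_of_constTransport P V Ψ R hthetaEq hconst i vQ, hR₀, hR']) hadm',
    logvol_eq_of_pi hR₀ hadm, hvol]

/-- **TEAM B CAPSTONE at the verbatim container, (Ind3)-idle case**: as abc-iut-c312-6's
`teamB_statement_of_qFrobEqualityAt`, with the residuals `hθ`, `hfin` REPLACED by the idle-(Ind3) hypothesis
`hconst` and finite support of the reference volumes `hfinR`; remaining residuals `hul_nonempty` and
`finite : P.ThetaFinite` (= the Statement's own first conjunct) + the B-INPUT `QFrobEqualityAt P 0`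
(GAP row G-c312-11-1 — NEVER asserted). [claim: Mochizuki2012, status: disputed] -/
theorem teamB_statement_of_qFrobEqualityAt_of_constTransport (hV : V.Realizes (S'.D P.n)) (hG : V.GeneratorsPreserve)
    (hΨ : ∀ (m : ℤ) (j : T.Label) (vQ : T.VQ), V.PreservesRegions j vQ (Ψ m j vQ))
    (hfrobAdm : ∀ (m : ℤ) (j : T.Label) (vQ : T.VQ) (A : Set (S'.L.Packet j vQ)),
      (S'.col P.n).frobAdm m j vQ A ↔
        ∃ R' : ∀ e, Set (V.X j vQ e),
          Ψ m j vQ '' (V.e j vQ '' A) = Set.pi univ R' ∧ ∀ e, V.adm j vQ e (R' e))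
    (hfrobLogvol : ∀ (m : ℤ) (j : T.Label) (vQ : T.VQ) (A : Set (S'.L.Packet j vQ)),
      (S'.col P.n).frobLogvol m j vQ A =
        ∑ e, V.w j vQ e * V.logμ j vQ e (Function.eval e '' (Ψ m j vQ '' (V.e j vQ '' A))))
    (hthetaEq : ∀ (m : ℤ) (i : Fin T.lstar) (vQ : T.VQ),
      V.e (Setting.labelSucc i) vQ '' P.thetaRegion m (Setting.labelSucc i) vQ =
        Ψ m (Setting.labelSucc i) vQ '' (V.e (Setting.labelSucc i) vQ '' R (Setting.labelSucc i) vQ))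
    (hR : ∀ (i : Fin T.lstar) (vQ : T.VQ), V.Adm (Setting.labelSucc i) vQ (R (Setting.labelSucc i) vQ))
    (hconst : ∀ (m : ℤ) (i : Fin T.lstar) (vQ : T.VQ),
      Ψ m (Setting.labelSucc i) vQ '' (V.e (Setting.labelSucc i) vQ '' R (Setting.labelSucc i) vQ) =
        Ψ 0 (Setting.labelSucc i) vQ '' (V.e (Setting.labelSucc i) vQ '' R (Setting.labelSucc i) vQ))
    (hfinR : ∀ i : Fin T.lstar, (Function.support fun vQ : T.VQ =>
      (S'.D P.n).logvol _ vQ (R (Setting.labelSucc i) vQ)).Finite)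
    (hul_nonempty : ∀ (j : T.Label) (vQ : T.VQ), ∀ H ∈ (P.frame j vQ).Hul, H.Nonempty)
    (finite : P.ThetaFinite) (h0 : QFrobEqualityAt P 0) : P.Statement := by
  have hfin : ∀ i : Fin T.lstar, (Function.support fun vQ : T.VQ =>
      (S'.D P.n).logvol _ vQ (P.thetaRegion3 (Setting.labelSucc i) vQ)).Finite := fun i => by
    have h : (fun vQ : T.VQ => (S'.D P.n).logvol _ vQ (P.thetaRegion3 (Setting.labelSucc i) vQ)) =
        fun vQ : T.VQ => (S'.D P.n).logvol _ vQ (R (Setting.labelSucc i) vQ) :=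
      funext fun vQ => logvol_thetaRegion3_eq_ref_of_constTransport P V Ψ R hV hΨ hthetaEq hR hconst i vQ
    rw [h]
    exact hfinR i
  exact teamB_statement_of_qFrobEqualityAt P V Ψ R hV hG hΨ hfrobAdm hfrobLogvol hthetaEq hR
    (thetaRegion3_adm_of_constTransport P V Ψ R hV hΨ hthetaEq hR hconst) hfin hul_nonempty finite h0

end SummandPieces

end Cor312Vol

end IUTFork

end Summit.ABC

end
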